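import Summits.KontsevichZagierPeriods.Zeta5Search.LaiSweepShard

/-!
# `κ₃` sweep certificate — shard file 108 of 127 (shards 756–762 of 889)

HONEST FRAMING. Systematic search; no irrationality claim unless certified. This file only checks,
by `decide +kernel`, shards 756–762 of the order-cell sweep of the `κ₃` point `(74, 2180, 444; δ74)`
(engine `LaiSweepEngine`, soundness `LaiSweepJump/Free/Eval/Shard/Kappa3`; a shard is `⟨regime, n,
p, q, p', q', Lo, Up⟩`: `n` cells from `p/q` to `p'/q'` with integer rate sums in `[Lo, Up]`, `K =
128`, `D = 2^40`). It draws NO conclusion: only the capstone `LaiKappa3SweepCert`, which needs all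
127 shard files, does. Kernel cost of this file ≈ 560 cells × 0.3 s.
-/

namespace Summit.KontsevichZagierPeriods.Zeta5Search.Sweep

set_option maxHeartbeats 100000000 in
/-- Shard 756: 80 cells of regime B from `319/383` to `358/429`.
[cite: Lai2024BallRivoal, §4 Lemma 4.3] -/
theorem shard756 :
    Shard.check 128 (2^40)
      ⟨true, 80, 319, 383, 358, 429, 13848950659615, 22144276537593⟩ = true := by
  decide +kernel

set_option maxHeartbeats 100000000 in
/-- Shard 757: 80 cells of regime B from `358/429` to `178/213`.
[cite: Lai2024BallRivoal, §4 Lemma 4.3] -/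
theorem shard757 :
    Shard.check 128 (2^40)
      ⟨true, 80, 358, 429, 178, 213, 10226465798904, 16370424276778⟩ = true := by
  decide +kernel

set_option maxHeartbeats 100000000 in
/-- Shard 758: 80 cells of regime B from `178/213` to `349/417`.
[cite: Lai2024BallRivoal, §4 Lemma 4.3] -/
theorem shard758 :
    Shard.check 128 (2^40)
      ⟨true, 80, 178, 213, 349, 417, 10807709547175, 17318441155356⟩ = true := by
  decide +kernel

set_option maxHeartbeats 100000000 in
/-- Shard 759: 80 cells of regime B from `349/417` to `259/309`.
[cite: Lai2024BallRivoal, §4 Lemma 4.3] -/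
theorem shard759 :
    Shard.check 128 (2^40)
      ⟨true, 80, 349, 417, 259, 309, 10867654847506, 17432712380479⟩ = true := by
  decide +kernel

set_option maxHeartbeats 100000000 in
/-- Shard 760: 80 cells of regime B from `259/309` to `251/299`.
[cite: Lai2024BallRivoal, §4 Lemma 4.3] -/
theorem shard760 :
    Shard.check 128 (2^40)
      ⟨true, 80, 259, 309, 251, 299, 11027168067031, 17707263249947⟩ = true := by
  decide +kernel

set_option maxHeartbeats 100000000 in
/-- Shard 761: 80 cells of regime B from `251/299` to `95/113`.
[cite: Lai2024BallRivoal, §4 Lemma 4.3] -/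
theorem shard761 :
    Shard.check 128 (2^40)
      ⟨true, 80, 251, 299, 95, 113, 10730387176101, 17248826872326⟩ = true := by
  decide +kernel

set_option maxHeartbeats 100000000 in
/-- Shard 762: 80 cells of regime B from `95/113` to `245/291`.
[cite: Lai2024BallRivoal, §4 Lemma 4.3] -/
theorem shard762 :
    Shard.check 128 (2^40)
      ⟨true, 80, 95, 113, 245, 291, 10490482200532, 16880424433912⟩ = true := by
  decide +kernel

/-- The checked shards of this file, in order. [folklore] -/
def shards108 : List (CheckedShard 128 (2^40)) :=
  [⟨_, shard756⟩, ⟨_, shard757⟩, ⟨_, shard758⟩, ⟨_, shard759⟩, ⟨_, shard760⟩,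
    ⟨_, shard761⟩, ⟨_, shard762⟩]

end Summit.KontsevichZagierPeriods.Zeta5Search.Sweep
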